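import Summits.QuantumFields.YangMills.Theorems.UnitScaleTiltHistoryTailBoundedHeight
import Summits.QuantumFields.YangMills.Theorems.UnitScaleTiltHistoryTailPerPlaquetteV3b
import Mathlib.Probability.Moments.Basic
import Mathlib.Analysis.Convex.Integral
import Mathlib.Analysis.SpecialFunctions.Log.NegMulLog
import HarnessLib

/-!
# crux-ideate 1/2 on stmt-QuantumFields-18916 → live crux stmt-QuantumFields-19936 `HistoryTailL` — gen-3 sketch (SORRY-FREE)

Seat `ym-cruxidea-18916-1` (planner, ideator 1 of 2), gen 3, 2026-08-27.  Two things are kernel-checked here: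

§1 **Re-target of cards A/B (gen 1) to the live crux.**  `historyTailL_of_ppHigh`: the per-plaquette high schema `PPHigh` at ONE
   profile per `L` (exactly the hypothesis shape of gen-1 `historyTail_of_ppHigh`, which cards A `unit-scale-insertion` and B
   `chessboard-symmetrised-insertion` produce) gives `HistoryTailL` — via the tree chain `perPlaquette_of_split` →
   `stub_tailOfPerPlaquette` → `historyTailAt_of_averagedTailAt` and the SIBLING'S monotone lift `historyTailL_of_profile`
   (ym-cruxidea-18916-2, gen 3, tree file `Cruxes/HistoryTail/IdeaMonoLift.lean` bf868c955ead — repeated verbatim in §0b ONLY because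
   the farm snapshot does not yet build `Cruxes/…` modules (`lean check` rc 75 `unbuilt:…IdeaMonoLift`); credit: the sibling's finding).

§2 **Card F `tilt-interpolation` — the typed first step.**  For a bounded random variable `X ≥ 0` and `t ≥ 0`, Jensen for the convex
   `y ↦ y log y` gives `log E[e^{tX}] ≤ t · E_{μ_t}[X]` (`μ_t ∝ e^{tX}μ` the TILTED law; `log_mgf_le_mul_tiltedMean`), hence the
   Chernoff bound `μ{x ≤ X} ≤ e^{−tx} · e^{t E_{μ_t}[X]}` (`measureReal_ge_le_of_tiltedMean`).  Specialised to
   `X = X_p^{(j)} := β_{K−j} · dist1(Ū^{j}(∂p))²` (the running-unit plaquette energy of the `j`-averaged field; `0 ≤ X ≤ 8β_{K−j}` on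
   `SU(2)` by (11) `dist1² ≤ 2N(1 − reTr)`), a TILTED-FIRST-MOMENT bound `t · E_{μ_t}[X_p^{(j)}] ≤ A log β_{K−j} + C` for ONE `t > 0`
   (`TiltedMeanBound`, engine (b) — NOT proved here), or directly a UNIFORM EXPONENTIAL-MOMENT bound `log E_K e^{tX_p^{(j)}} ≤ A log β_{K−j} + C`
   (`LogMgfBound`, engine (a) = the local generating function at a finite real source; (b) ⇒ (a) PROVED), yields `PPHigh` with Gaussian
   constant `c = t` (rate `C β^A e^{−t·p(g)²}`) at EVERY profile (`ppHigh_of_logMgfBound`, `ppHigh_of_tiltedMeanBound`), hence `HistoryTailL`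
   (`historyTailL_of_logMgfBoundL`, `historyTailL_of_tiltedMeanBoundL`).  `plaqX_le_wilson`: `t X_p ≤ 4t·β_{K−j}(1 − reTr Ū^{j}(∂p))` — for
   `t < ¼` the tilt is a ONE-PLAQUETTE COUPLING DEFECT inside the main term (positive action), not a polymer activity.  No `sorry` in this file:
   the engines are hypotheses (`def … : Prop`), everything else is proved.
-/

open MeasureTheory ProbabilityTheory
open Literature.MathematicalPhysics.QuantumFieldTheory.Balaban1983to89
open Literature.MathematicalPhysics.QuantumFieldTheory.Balaban1983to89.T3ContinuumYM3Torus
open Literature.MathematicalPhysics.QuantumFieldTheory.Balaban1983to89.T3UnitScaleTilt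
open Literature.MathematicalPhysics.QuantumFieldTheory.Balaban1983to89.T3UnitLawDensityEML
open Literature.MathematicalPhysics.QuantumFieldTheory.Balaban1983to89.T3BareTailProfile
open Literature.MathematicalPhysics.QuantumFieldTheory.Balaban1983to89.Missing (measurable_plaqHol)
open Literature.MathematicalPhysics.QuantumFieldTheory.Balaban1983to89.T4Continuum (measurable_iter)
open Summit.QuantumFields.YangMills.Theorems
open Summit.QuantumFields.YangMills.Theses.UnitScaleTilt (HistoryTailL)

namespace Summit.QuantumFields.YangMills.Cruxes.HistoryTailL.IdeasG3

/-! ## §0 Generic probability: the tilted mean controls the log-mgf (Jensen for `y log y`) and hence the upper tail (Chernoff) -/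

section Tilt

variable {Ω : Type*} [MeasurableSpace Ω] {μ : Measure Ω} [IsProbabilityMeasure μ] {X : Ω → ℝ} {t b : ℝ}

/-- The TILTED MEAN `E_{μ_t}[X] = E[X e^{tX}] / E[e^{tX}]` of `X` under `μ_t ∝ e^{tX} μ`. -/
noncomputable def tiltedMean (μ : Measure Ω) (X : Ω → ℝ) (t : ℝ) : ℝ :=
  (∫ ω, X ω * Real.exp (t * X ω) ∂μ) / mgf X μ t

omit [IsProbabilityMeasure μ] in
theorem integrable_mul_exp_mul [IsFiniteMeasure μ] (ht : 0 ≤ t) (hX : AEMeasurable X μ)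
    (h0 : ∀ᵐ ω ∂μ, 0 ≤ X ω) (hb : ∀ᵐ ω ∂μ, X ω ≤ b) :
    Integrable (fun ω => X ω * Real.exp (t * X ω)) μ := by
  refine Integrable.of_mem_Icc 0 (b * Real.exp (t * b))
    (hX.mul (Real.measurable_exp.comp_aemeasurable (hX.const_mul t))) ?_
  filter_upwards [h0, hb] with ω h0 hb
  refine ⟨mul_nonneg h0 (Real.exp_nonneg _), ?_⟩
  exact mul_le_mul hb (Real.exp_le_exp.mpr (mul_le_mul_of_nonneg_left hb ht)) (Real.exp_nonneg _) (h0.trans hb)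

/-- **`log E[e^{tX}] ≤ t · E_{μ_t}[X]`** for bounded `X ≥ 0`, `t ≥ 0`: Jensen for the convex `y ↦ y log y` applied to `Y = e^{tX}`
(equivalently: the relative entropy `H(μ_t | μ) = t E_{μ_t}[X] − log E[e^{tX}]` is nonnegative). -/
theorem log_mgf_le_mul_tiltedMean (ht : 0 ≤ t) (hX : AEMeasurable X μ)
    (h0 : ∀ᵐ ω ∂μ, 0 ≤ X ω) (hb : ∀ᵐ ω ∂μ, X ω ≤ b) :
    Real.log (mgf X μ t) ≤ t * tiltedMean μ X t := by
  have hYi : Integrable (fun ω => Real.exp (t * X ω)) μ := integrable_exp_mul_of_le t b ht hX hb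
  have hXe : Integrable (fun ω => X ω * Real.exp (t * X ω)) μ := integrable_mul_exp_mul ht hX h0 hb
  have hgi : Integrable ((fun y : ℝ => y * Real.log y) ∘ fun ω => Real.exp (t * X ω)) μ := by
    refine (hXe.const_mul t).congr (Filter.Eventually.of_forall fun ω => ?_)
    simp only [Function.comp_apply, Real.log_exp]
    ring
  have hJ := ConvexOn.map_integral_le (μ := μ) (f := fun ω => Real.exp (t * X ω)) Real.convexOn_mul_log
    Real.continuous_mul_log.continuousOn isClosed_Ici
    (Filter.Eventually.of_forall fun ω => (Real.exp_nonneg _ : (0 : ℝ) ≤ Real.exp (t * X ω))) hYi hgi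
  -- `hJ : (∫ Y) * log (∫ Y) ≤ ∫ Y log Y`
  have hrhs : ∫ ω, Real.exp (t * X ω) * Real.log (Real.exp (t * X ω)) ∂μ =
      t * ∫ ω, X ω * Real.exp (t * X ω) ∂μ := by
    rw [← integral_const_mul]
    refine integral_congr_ae (Filter.Eventually.of_forall fun ω => ?_)
    simp only [Real.log_exp]
    ring
  have hZ : 0 < mgf X μ t := mgf_pos hYi
  have hZdef : mgf X μ t = ∫ ω, Real.exp (t * X ω) ∂μ := rfl
  rw [tiltedMean, mul_div_assoc', le_div_iff₀ hZ, hZdef, mul_comm (Real.log _), ← hrhs]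
  exact hJ

/-- **Chernoff from a tilted first moment**: `μ{x ≤ X} ≤ e^{−tx} e^{M}` whenever `t·E_{μ_t}[X] ≤ M` (bounded `X ≥ 0`, `t ≥ 0`). -/
theorem measureReal_ge_le_of_tiltedMean (ht : 0 ≤ t) (hX : AEMeasurable X μ)
    (h0 : ∀ᵐ ω ∂μ, 0 ≤ X ω) (hb : ∀ᵐ ω ∂μ, X ω ≤ b) {M : ℝ} (hM : t * tiltedMean μ X t ≤ M) (x : ℝ) :
    μ.real {ω | x ≤ X ω} ≤ Real.exp (-(t * x)) * Real.exp M := by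
  have hYi : Integrable (fun ω => Real.exp (t * X ω)) μ := integrable_exp_mul_of_le t b ht hX hb
  have h1 := measure_ge_le_exp_mul_mgf x ht hYi
  have hZ : 0 < mgf X μ t := mgf_pos hYi
  have h2 : mgf X μ t ≤ Real.exp M := by
    rw [← Real.exp_log hZ]
    exact Real.exp_le_exp.mpr ((log_mgf_le_mul_tiltedMean ht hX h0 hb).trans hM)
  calc μ.real {ω | x ≤ X ω} ≤ Real.exp (-t * x) * mgf X μ t := h1
    _ ≤ Real.exp (-(t * x)) * Real.exp M := by
        rw [neg_mul]; exact mul_le_mul_of_nonneg_left h2 (Real.exp_nonneg _)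

end Tilt

/-! ## §0b The sibling's monotone lift (VERBATIM from `Cruxes/HistoryTail/IdeaMonoLift.lean`, ym-cruxidea-18916-2 gen 3 — not claimed here) -/

section SiblingMonoLift

theorem pFun_mono {b₀ b₀' p₀ p₀' g : ℝ} (hb : 0 ≤ b₀) (hbb : b₀ ≤ b₀') (hpp : p₀ ≤ p₀') (hg : 0 < g) (hg1 : g ≤ 1) :
    B10.pFun b₀ p₀ g ≤ B10.pFun b₀' p₀' g := by
  unfold B10.pFun
  have hlog : 0 ≤ Real.log g⁻¹ := by
    rw [Real.log_inv]
    have := Real.log_nonpos hg.le hg1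
    linarith
  have ht : (1 : ℝ) ≤ 1 + Real.log g⁻¹ := by linarith
  have h1 : (1 + Real.log g⁻¹) ^ p₀ ≤ (1 + Real.log g⁻¹) ^ p₀' := Real.rpow_le_rpow_of_exponent_le ht hpp
  have h2 : 0 ≤ (1 + Real.log g⁻¹) ^ p₀' := Real.rpow_nonneg (by linarith) _
  calc b₀ * (1 + Real.log g⁻¹) ^ p₀ ≤ b₀ * (1 + Real.log g⁻¹) ^ p₀' := mul_le_mul_of_nonneg_left h1 hb
    _ ≤ b₀' * (1 + Real.log g⁻¹) ^ p₀' := mul_le_mul_of_nonneg_right hbb h2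

theorem sqrt_coupling_mem {L : ℕ} (hL : 1 ≤ L) {γ : ℝ} (hγ : 0 < γ) (hγ1 : γ ≤ 1) (i : ℕ) :
    0 < Real.sqrt (γ * ((L : ℝ)⁻¹) ^ i) ∧ Real.sqrt (γ * ((L : ℝ)⁻¹) ^ i) ≤ 1 := by
  have hL' : (1 : ℝ) ≤ L := by exact_mod_cast hL
  have hLi : 0 < ((L : ℝ)⁻¹) ^ i := pow_pos (inv_pos.mpr (by linarith)) i
  have hLi1 : ((L : ℝ)⁻¹) ^ i ≤ 1 := pow_le_one₀ (inv_nonneg.mpr (by linarith)) (inv_le_one_of_one_le₀ hL')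
  refine ⟨Real.sqrt_pos.mpr (mul_pos hγ hLi), Real.sqrt_le_one.mpr ?_⟩
  calc γ * ((L : ℝ)⁻¹) ^ i ≤ 1 * 1 := mul_le_mul hγ1 hLi1 hLi.le zero_le_one
    _ = 1 := one_mul 1

theorem θBal_mono {L : ℕ} (hL : 1 ≤ L) {γ b₀ b₀' p₀ p₀' : ℝ} (hγ : 0 < γ) (hγ1 : γ ≤ 1)
    (hb : 0 ≤ b₀) (hbb : b₀ ≤ b₀') (hpp : p₀ ≤ p₀') (i : ℕ) :
    θBal L γ b₀ p₀ i ≤ θBal L γ b₀' p₀' i := by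
  unfold θBal
  obtain ⟨h0, h1⟩ := sqrt_coupling_mem hL hγ hγ1 i
  exact mul_le_mul_of_nonneg_left (pFun_mono hb hbb hpp h0 h1) h0.le

theorem histGood_mono (F : T3Family) {G : Type*} [GaugeGroup G] [MeasurableSpace G] [RegularGaugeGroup G]
    (ℰ : LoopAverage G) {θ θ' : ℕ → ℝ} (h : ∀ i, θ i ≤ θ' i) (K n : ℕ) :
    histGood F ℰ θ K n ⊆ histGood F ℰ θ' K n := by
  intro U hU j hj p
  exact lt_of_lt_of_le (hU j hj p) (h _)

theorem historyTailAt_mono (F : T3Family) {γ b₀ b₀' p₀ p₀' : ℝ} {m : ℕ} (hγ : 0 < γ) (hγ1 : γ ≤ 1)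
    (hb : 0 ≤ b₀) (hbb : b₀ ≤ b₀') (hpp : p₀ ≤ p₀')
    (h : HistoryTailAt F γ b₀ p₀ m) : HistoryTailAt F γ b₀' p₀' m := by
  obtain ⟨w, hw, hK⟩ := h
  have hL1 : 1 ≤ F.L := F.hL.2.le
  have hθ : ∀ i, θBal F.L γ b₀ p₀ i ≤ θBal F.L γ b₀' p₀' i := θBal_mono hL1 hγ hγ1 hb hbb hpp
  have hsub : ∀ K n, (histGood F ℰp (θBal F.L γ b₀' p₀') K n)ᶜ ⊆ (histGood F ℰp (θBal F.L γ b₀ p₀) K n)ᶜ :=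
    fun K n => Set.compl_subset_compl.mpr (histGood_mono F ℰp hθ K n)
  refine ⟨w, hw, fun K => ?_⟩
  haveI := isProbabilityMeasure_gibbsK F ℰp hγ.le K
  haveI := isProbabilityMeasure_gibbsK F ℰp hγ.le (K + 1)
  exact ⟨(measureReal_mono (hsub K _)).trans (hK K).1, (measureReal_mono (hsub (K + 1) _)).trans (hK K).2⟩

/-- One profile per `L` (chosen before `m`) serves every pair of thresholds (sibling's `historyTailL_of_profile`). -/
theorem historyTailL_of_profile
    (h : ∀ (L : ℕ), ∃ (b₀ p₀ : ℝ), 0 < b₀ ∧ 2 < p₀ ∧ ∀ (m : ℕ), 0 < m → ∃ γ₁ : ℝ, 0 < γ₁ ∧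
      ∀ (F : T3Family) (γ : ℝ), F.L = L → 0 < γ → γ ≤ γ₁ → HistoryTailAt F γ b₀ p₀ m) :
    HistoryTailL := by
  intro L b₁ p₁
  obtain ⟨b₀, p₀, hb, hp, hm⟩ := h L
  refine ⟨max b₀ b₁, max p₀ p₁, le_max_right _ _, le_max_right _ _, lt_max_of_lt_left hb, lt_max_of_lt_left hp,
    fun m hm0 => ?_⟩
  obtain ⟨γ₁, hγ₁, hT⟩ := hm m hm0
  refine ⟨min γ₁ 1, lt_min hγ₁ one_pos, fun F γ hFL hγ hle => ?_⟩
  exact historyTailAt_mono F hγ (hle.trans (min_le_right _ _)) hb.le (le_max_left _ _) (le_max_left _ _)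
    (hT F γ hFL hγ (hle.trans (min_le_left _ _)))

end SiblingMonoLift

/-! ## §1 The per-plaquette schema at ONE profile per `L` gives the LIVE crux `HistoryTailL` (re-target of cards A/B) -/

/-- The gauge group of the route. -/
abbrev SU2 := Matrix.specialUnitaryGroup (Fin 2) ℂ

variable (F : T3Family)

/-- The height-`j` BAD-PLAQUETTE EVENT of run `K` at `p ∈ T^{(j)}` (the set of v4 `stub_perPlaquetteHighRaw` / gen-1 `badEv`). -/
def badEv (γ b₀ p₀ : ℝ) (K j : ℕ) (p : Plaq (F.P K) j) : Set (GaugeField (F.P K) 0 SU2) :=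
  {U | θBal F.L γ b₀ p₀ (K - j) ≤
    GaugeGroup.dist1 (GaugeField.plaqHol (Averaging.iter (fun _ => BlockAveraging.blockAvg ℰp) j U) p)}

/-- Bałaban's large-field amplitude at height `j` of run `K`: `p_{K−j} = pFun b₀ p₀ (√(γ L^{-(K−j)}))`. -/
noncomputable def pAmp (γ b₀ p₀ : ℝ) (K j : ℕ) : ℝ :=
  B10.pFun b₀ p₀ (Real.sqrt (γ * ((F.L : ℝ)⁻¹) ^ (K - j)))

/-- The PER-PLAQUETTE HIGH SCHEMA with a free Gaussian constant `c` (input of `HistoryTailBoundedHeight.perPlaquette_of_split`). -/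
def PPHigh (γ b₀ p₀ : ℝ) (j₀ : ℕ) : Prop :=
  ∃ (C : ℝ) (A : ℕ) (c : ℝ), 0 ≤ C ∧ 0 < c ∧ ∀ (K j : ℕ), j₀ < j → j ≤ K → ∀ p : Plaq (F.P K) j,
    (gibbsK F ℰp γ K).real (badEv F γ b₀ p₀ K j p) ≤
      C * (F.scheme ℰp γ).β (K - j) ^ A * Real.exp (-(c * pAmp F γ b₀ p₀ K j ^ 2))

/-- `PPHigh` at one profile `(b₀, p₀)` with `0 < b₀`, `1 ≤ p₀` gives `HistoryTailAt` there for every `m ≥ 1` (the landed v3b/v4 chain). -/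
theorem historyTailAt_of_ppHigh {γ b₀ p₀ : ℝ} (hγ : 0 < γ) (hγ1 : γ ≤ 1) (hb : 0 < b₀) (hp : 1 ≤ p₀) {j₀ : ℕ}
    (h : PPHigh F γ b₀ p₀ j₀) {m : ℕ} (hm : 0 < m) : HistoryTailAt F γ b₀ p₀ m := by
  obtain ⟨C, A, c, hC, hc, hhigh⟩ := h
  have hhigh' : ∃ (C : ℝ) (A : ℕ) (c : ℝ), 0 ≤ C ∧ 0 < c ∧ ∀ (K j : ℕ), j₀ < j → j ≤ K → ∀ p : Plaq (F.P K) j,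
      (gibbsK F ℰp γ K).real
          {U | θBal F.L γ b₀ p₀ (K - j) ≤
            GaugeGroup.dist1 (GaugeField.plaqHol (Averaging.iter (fun _ => BlockAveraging.blockAvg ℰp) j U) p)} ≤
        C * (F.scheme ℰp γ).β (K - j) ^ A *
          Real.exp (-(c * B10.pFun b₀ p₀ (Real.sqrt (γ * ((F.L : ℝ)⁻¹) ^ (K - j))) ^ 2)) :=
    ⟨C, A, c, hC, hc, fun K j hj hjK p => hhigh K j hj hjK p⟩
  have hPP := HistoryTailBoundedHeight.perPlaquette_of_split j₀ F hγ hγ1 hb.le p₀ hhigh'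
  exact historyTailAt_of_averagedTailAt F hγ hγ1 hb hp hm
    (HistoryTailBirthV3b.stub_tailOfPerPlaquette F γ b₀ p₀ hγ hγ1 hb hp hPP)

/-- **Re-target of cards A/B.**  The hypothesis is VERBATIM that of gen-1 `historyTail_of_ppHigh` (one profile `(b₀,p₀)` and one
coupling threshold `γ₁` per odd `L > 1`, chosen before anything else); the conclusion is now the live crux `HistoryTailL`
(stmt-QuantumFields-19936), through the sibling's `historyTailL_of_profile` (profile monotonicity of `HistoryTailAt`). -/
theorem historyTailL_of_ppHigh
    (h : ∀ (L : ℕ), Odd L → 1 < L → ∃ b₀ p₀ γ₁ : ℝ, 0 < b₀ ∧ 2 < p₀ ∧ 0 < γ₁ ∧ γ₁ ≤ 1 ∧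
      ∀ (F : T3Family) (γ : ℝ), F.L = L → 0 < γ → γ ≤ γ₁ → ∃ j₀ : ℕ, PPHigh F γ b₀ p₀ j₀) :
    HistoryTailL := by
  refine historyTailL_of_profile fun L => ?_
  by_cases hL : Odd L ∧ 1 < L
  · obtain ⟨b₀, p₀, γ₁, hb, hp, hγ₁, hγ₁1, hF⟩ := h L hL.1 hL.2
    refine ⟨b₀, p₀, hb, hp, fun m hm => ⟨γ₁, hγ₁, fun F γ hFL hγ hγle => ?_⟩⟩
    obtain ⟨j₀, hPP⟩ := hF F γ hFL hγ hγle
    exact historyTailAt_of_ppHigh F hγ (hγle.trans hγ₁1) hb (by linarith) hPP hm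
  · refine ⟨1, 3, one_pos, by norm_num, fun m _ => ⟨1, one_pos, fun F γ hFL _ _ => ?_⟩⟩
    exact absurd (And.intro (hFL ▸ F.hL.1) (hFL ▸ F.hL.2)) hL

/-! ## §2 Card F `tilt-interpolation`: PPHigh ⟸ ONE tilted first moment of the running-unit plaquette energy -/

/-- The RUNNING-UNIT PLAQUETTE ENERGY of the `j`-averaged field at `p ∈ T^{(j)}`: `X_p^{(j)}(U) = β_{K−j} · |Ū^{j}(∂p) − 1|²`
(`β_{K−j} = (γ L^{-(K−j)})⁻¹ = g_{K−j}⁻²`, `|·| = dist1` = operator norm). -/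
noncomputable def plaqX (γ : ℝ) (K j : ℕ) (p : Plaq (F.P K) j) (U : GaugeField (F.P K) 0 SU2) : ℝ :=
  (F.scheme ℰp γ).β (K - j) *
    GaugeGroup.dist1 (GaugeField.plaqHol (Averaging.iter (fun _ => BlockAveraging.blockAvg ℰp) j U) p) ^ 2

theorem measurable_plaqX (γ : ℝ) (K j : ℕ) (p : Plaq (F.P K) j) : Measurable (plaqX F γ K j p) :=
  (((RegularGaugeGroup.measurable_dist1.comp (measurable_plaqHol p)).comp
    (measurable_iter _ (F.avgMeasurable_of_measurableE ℰp measurableE_ℰp K) j)).pow_const 2).const_mul _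

theorem plaqX_nonneg {γ : ℝ} (hγ : 0 ≤ γ) (K j : ℕ) (p : Plaq (F.P K) j) (U : GaugeField (F.P K) 0 SU2) :
    0 ≤ plaqX F γ K j p U :=
  mul_nonneg (F.scheme_β_nonneg ℰp hγ _) (sq_nonneg _)

/-- `X_p^{(j)} ≤ 8 β_{K−j}` on `SU(2)`: (11) `dist1 W² ≤ 2N(1 − reTr W)` and `−1 ≤ reTr W`. -/
theorem plaqX_le {γ : ℝ} (hγ : 0 ≤ γ) (K j : ℕ) (p : Plaq (F.P K) j) (U : GaugeField (F.P K) 0 SU2) :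
    plaqX F γ K j p U ≤ 8 * (F.scheme ℰp γ).β (K - j) := by
  set W := GaugeField.plaqHol (Averaging.iter (fun _ => BlockAveraging.blockAvg ℰp) j U) p
  have h11 := B10Eq71TorusLocal.dist1_sq_le_specialUnitaryGroup (N := 2) W
  have hre := RegularGaugeGroup.neg_one_le_reTr W
  have hβ := F.scheme_β_nonneg ℰp hγ (K - j)
  have h8 : GaugeGroup.dist1 W ^ 2 ≤ 8 := by
    have : ((2 : ℕ) : ℝ) = 2 := by norm_num
    rw [this] at h11
    nlinarith
  unfold plaqX
  nlinarith

/-- **Absorption inequality** (why a tilt `t < ¼` keeps the action positive): `X_p^{(j)} ≤ 4 β_{K−j} (1 − reTr Ū^{j}(∂p))`, i.e. `t·X_p`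
is dominated by `4t` times `p`'s own Wilson plaquette term at running coupling `β_{K−j}` ((11) with `N = 2`; for the tree's `SU(2)` instance the
identity `1 − reTr = ½ dist1²` is in fact exact, so `X_p = 2β(1 − reTr)` and the true threshold is `t < ½` — not needed below). -/
theorem plaqX_le_wilson {γ : ℝ} (hγ : 0 ≤ γ) (K j : ℕ) (p : Plaq (F.P K) j) (U : GaugeField (F.P K) 0 SU2) :
    plaqX F γ K j p U ≤ 4 * (F.scheme ℰp γ).β (K - j) *
      (1 - GaugeGroup.reTr (GaugeField.plaqHol (Averaging.iter (fun _ => BlockAveraging.blockAvg ℰp) j U) p)) := by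
  set W := GaugeField.plaqHol (Averaging.iter (fun _ => BlockAveraging.blockAvg ℰp) j U) p
  have h11 := B10Eq71TorusLocal.dist1_sq_le_specialUnitaryGroup (N := 2) W
  have hβ := F.scheme_β_nonneg ℰp hγ (K - j)
  have h4 : GaugeGroup.dist1 W ^ 2 ≤ 4 * (1 - GaugeGroup.reTr W) := by
    have : ((2 : ℕ) : ℝ) = 2 := by norm_num
    rw [this] at h11
    linarith
  unfold plaqX
  calc (F.scheme ℰp γ).β (K - j) * GaugeGroup.dist1 W ^ 2
      ≤ (F.scheme ℰp γ).β (K - j) * (4 * (1 - GaugeGroup.reTr W)) := mul_le_mul_of_nonneg_left h4 hβ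
    _ = 4 * (F.scheme ℰp γ).β (K - j) * (1 - GaugeGroup.reTr W) := by ring

/-- The bad event is a super-level set of `X_p^{(j)}`: `θBal(K−j) ≤ dist1 ⇒ p_{K−j}² ≤ X_p^{(j)}` (`θBal = g·p(g)`, `β = g⁻²`). -/
theorem badEv_subset_plaqX {γ : ℝ} (hγ : 0 < γ) (hγ1 : γ ≤ 1) {b₀ : ℝ} (hb₀ : 0 ≤ b₀) (p₀ : ℝ) (K j : ℕ)
    (p : Plaq (F.P K) j) :
    badEv F γ b₀ p₀ K j p ⊆ {U | pAmp F γ b₀ p₀ K j ^ 2 ≤ plaqX F γ K j p U} := by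
  intro U hU
  simp only [badEv, Set.mem_setOf_eq, θBal] at hU
  simp only [Set.mem_setOf_eq, plaqX, pAmp]
  set x := γ * ((F.L : ℝ)⁻¹) ^ (K - j) with hx_def
  set d := GaugeGroup.dist1 (GaugeField.plaqHol (Averaging.iter (fun _ => BlockAveraging.blockAvg ℰp) j U) p)
  set P := B10.pFun b₀ p₀ (Real.sqrt x)
  have hL1 : 1 ≤ F.L := F.hL.2.le
  obtain ⟨hg0, hg1⟩ := T3ThresholdSmallness.sqrt_coupling_pos_le hL1 hγ (K - j)
  have hg1' : Real.sqrt x ≤ 1 := hg1.trans (Real.sqrt_le_one.mpr hγ1)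
  have hx : 0 < x := by
    have hL' : (0 : ℝ) < F.L := by exact_mod_cast (lt_trans zero_lt_one F.hL.2)
    exact mul_pos hγ (pow_pos (inv_pos.mpr hL') _)
  have hP : 0 ≤ P := B10.pFun_nonneg b₀ p₀ _ hb₀ hg0 hg1'
  have hβ : (F.scheme ℰp γ).β (K - j) = x⁻¹ := rfl
  have hd : 0 ≤ d := GaugeGroup.dist1_nonneg _
  -- square `√x · P ≤ d`
  have hsq : x * P ^ 2 ≤ d ^ 2 := by
    have h1 : (Real.sqrt x * P) ^ 2 ≤ d ^ 2 := pow_le_pow_left₀ (mul_nonneg hg0.le hP) hU 2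
    rw [mul_pow, Real.sq_sqrt hx.le] at h1
    exact h1
  rw [hβ, inv_mul_eq_div, le_div_iff₀ hx]
  calc P ^ 2 * x = x * P ^ 2 := mul_comm _ _
    _ ≤ d ^ 2 := hsq

/-- **ENGINE, moment form (card F (a)): UNIFORM EXPONENTIAL MOMENT / local generating function.**  For ONE `t > 0`:
`log E_K exp(t X_p^{(j)}) ≤ A log β_{K−j} + C` uniformly in the cutoff `K`, the height `j > j₀` and the plaquette `p` (`A`, `C` may depend on
`F`, `γ`, `t`: volume dependence allowed, cutoff dependence not).  Equivalently `Z_K[t]/Z_K ≤ e^{C} β_{K−j}^{A}` where `Z_K[t]` carries the ONE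
fat-plaquette insertion `exp(t β_{K−j}|Ū^{j}(∂p) − 1|²)` — a bound on the GENERATING FUNCTION at a finite real local source. -/
def LogMgfBound (γ t : ℝ) (j₀ : ℕ) : Prop :=
  ∃ (A : ℕ) (C : ℝ), ∀ (K j : ℕ), j₀ < j → j ≤ K → ∀ p : Plaq (F.P K) j,
    Real.log (mgf (plaqX F γ K j p) (gibbsK F ℰp γ K) t) ≤ A * Real.log ((F.scheme ℰp γ).β (K - j)) + C

/-- **ENGINE, tilted form (card F (b)): TILTED FIRST MOMENT.**  For ONE tilt `t > 0`: the mean running-unit plaquette energy of the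
`j`-averaged field under the ONE-PLAQUETTE-TILTED law `μ_t ∝ e^{t X_p^{(j)}} · gibbsK` is `O(log β_{K−j})` uniformly in `K`, `j > j₀`, `p`.
For `t < ¼` (`< ½` with the exact `SU(2)` identity) the tilt is dominated pointwise by `p`'s own Wilson term at its scale (`plaqX_le_wilson`), i.e.
`μ_t` is the same lattice gauge theory with ONE height-`(K−j)` plaquette coupling weakened to `(1 − 4t)β_{K−j}` — a positive-action theory. -/
def TiltedMeanBound (γ t : ℝ) (j₀ : ℕ) : Prop :=
  ∃ (A : ℕ) (C : ℝ), ∀ (K j : ℕ), j₀ < j → j ≤ K → ∀ p : Plaq (F.P K) j,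
    t * tiltedMean (gibbsK F ℰp γ K) (plaqX F γ K j p) t ≤ A * Real.log ((F.scheme ℰp γ).β (K - j)) + C

/-- (b) ⇒ (a): Jensen for `y log y` (`log_mgf_le_mul_tiltedMean`), PROVED. -/
theorem logMgfBound_of_tiltedMeanBound {γ t : ℝ} (hγ : 0 < γ) (ht : 0 ≤ t) {j₀ : ℕ} (h : TiltedMeanBound F γ t j₀) :
    LogMgfBound F γ t j₀ := by
  obtain ⟨A, C, hAC⟩ := h
  refine ⟨A, C, fun K j hj hjK p => ?_⟩
  haveI := isProbabilityMeasure_gibbsK F ℰp hγ.le K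
  exact (log_mgf_le_mul_tiltedMean ht (measurable_plaqX F γ K j p).aemeasurable
    (Filter.Eventually.of_forall fun U => plaqX_nonneg F hγ.le K j p U)
    (Filter.Eventually.of_forall fun U => plaqX_le F hγ.le K j p U)).trans (hAC K j hj hjK p)

/-- **Card F reduction, moment form (PROVED): a log-mgf bound at ONE `t > 0` gives `PPHigh` at EVERY profile, Gaussian constant `c = t`**
(rate `C β^A e^{−t·p_{K−j}²}` with `C = e^{C'}`; Chernoff `measure_ge_le_exp_mul_mgf`). -/
theorem ppHigh_of_logMgfBound {γ t : ℝ} (hγ : 0 < γ) (hγ1 : γ ≤ 1) (ht : 0 < t) {j₀ : ℕ}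
    (h : LogMgfBound F γ t j₀) {b₀ : ℝ} (hb₀ : 0 ≤ b₀) (p₀ : ℝ) : PPHigh F γ b₀ p₀ j₀ := by
  obtain ⟨A, C, hAC⟩ := h
  refine ⟨Real.exp C, A, t, (Real.exp_pos C).le, ht, fun K j hj hjK p => ?_⟩
  haveI := isProbabilityMeasure_gibbsK F ℰp hγ.le K
  set μ := gibbsK F ℰp γ K
  set X := plaqX F γ K j p
  set β := (F.scheme ℰp γ).β (K - j)
  have hβpos : 0 < β := by
    have hL' : (0 : ℝ) < F.L := by exact_mod_cast (lt_trans zero_lt_one F.hL.2)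
    show 0 < (F.scheme ℰp γ).β (K - j)
    exact inv_pos.mpr (mul_pos hγ (pow_pos (inv_pos.mpr hL') _))
  have hXm : AEMeasurable X μ := (measurable_plaqX F γ K j p).aemeasurable
  have hb : ∀ᵐ U ∂μ, X U ≤ 8 * β := Filter.Eventually.of_forall fun U => plaqX_le F hγ.le K j p U
  have hYi : Integrable (fun U => Real.exp (t * X U)) μ := integrable_exp_mul_of_le t (8 * β) ht.le hXm hb
  have hZ : 0 < mgf X μ t := mgf_pos hYi
  have hmgf : mgf X μ t ≤ Real.exp (A * Real.log β + C) := by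
    rw [← Real.exp_log hZ]
    exact Real.exp_le_exp.mpr (hAC K j hj hjK p)
  have htail := measure_ge_le_exp_mul_mgf (μ := μ) (X := X) (pAmp F γ b₀ p₀ K j ^ 2) ht.le hYi
  have hmono : μ.real (badEv F γ b₀ p₀ K j p) ≤ μ.real {U | pAmp F γ b₀ p₀ K j ^ 2 ≤ X U} :=
    measureReal_mono (badEv_subset_plaqX F hγ hγ1 hb₀ p₀ K j p)
  have hexpA : Real.exp (A * Real.log β + C) = Real.exp C * β ^ A := by
    rw [Real.exp_add, ← Real.rpow_natCast, Real.rpow_def_of_pos hβpos, mul_comm (Real.log β)]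
    ring
  calc μ.real (badEv F γ b₀ p₀ K j p) ≤ μ.real {U | pAmp F γ b₀ p₀ K j ^ 2 ≤ X U} := hmono
    _ ≤ Real.exp (-t * pAmp F γ b₀ p₀ K j ^ 2) * mgf X μ t := htail
    _ ≤ Real.exp (-t * pAmp F γ b₀ p₀ K j ^ 2) * Real.exp (A * Real.log β + C) :=
        mul_le_mul_of_nonneg_left hmgf (Real.exp_nonneg _)
    _ = Real.exp C * β ^ A * Real.exp (-(t * pAmp F γ b₀ p₀ K j ^ 2)) := by
        rw [hexpA, neg_mul]; ring

/-- **Card F reduction, tilted form (PROVED)**: a tilted first-moment bound at ONE `t > 0` gives `PPHigh` at EVERY profile, `c = t`. -/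
theorem ppHigh_of_tiltedMeanBound {γ t : ℝ} (hγ : 0 < γ) (hγ1 : γ ≤ 1) (ht : 0 < t) {j₀ : ℕ}
    (h : TiltedMeanBound F γ t j₀) {b₀ : ℝ} (hb₀ : 0 ≤ b₀) (p₀ : ℝ) : PPHigh F γ b₀ p₀ j₀ :=
  ppHigh_of_logMgfBound F hγ hγ1 ht (logMgfBound_of_tiltedMeanBound F hγ ht.le h) hb₀ p₀

/-- The engine over the route's quantifiers: ONE tilt `t` and ONE coupling threshold per odd `L > 1`. -/
def TiltedMeanBoundL : Prop :=
  ∀ (L : ℕ), Odd L → 1 < L → ∃ t γ₁ : ℝ, 0 < t ∧ 0 < γ₁ ∧ γ₁ ≤ 1 ∧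
    ∀ (F : T3Family) (γ : ℝ), F.L = L → 0 < γ → γ ≤ γ₁ → ∃ j₀ : ℕ, TiltedMeanBound F γ t j₀

/-- **Card F concludes the live crux**: `TiltedMeanBoundL → HistoryTailL` (profile `(1, 3)`, or any other — the tilt bound is profile-free). -/
theorem historyTailL_of_tiltedMeanBoundL (h : TiltedMeanBoundL) : HistoryTailL := by
  refine historyTailL_of_ppHigh fun L hLo hL1 => ?_
  obtain ⟨t, γ₁, ht, hγ₁, hγ₁1, hF⟩ := h L hLo hL1
  refine ⟨1, 3, γ₁, one_pos, by norm_num, hγ₁, hγ₁1, fun F γ hFL hγ hγle => ?_⟩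
  obtain ⟨j₀, hT⟩ := hF F γ hFL hγ hγle
  exact ⟨j₀, ppHigh_of_tiltedMeanBound F hγ (hγle.trans hγ₁1) ht hT zero_le_one 3⟩


/-- Engine (a) over the route's quantifiers: ONE `t` and ONE coupling threshold per odd `L > 1`. -/
def LogMgfBoundL : Prop :=
  ∀ (L : ℕ), Odd L → 1 < L → ∃ t γ₁ : ℝ, 0 < t ∧ 0 < γ₁ ∧ γ₁ ≤ 1 ∧
    ∀ (F : T3Family) (γ : ℝ), F.L = L → 0 < γ → γ ≤ γ₁ → ∃ j₀ : ℕ, LogMgfBound F γ t j₀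

/-- **Card F (a) concludes the live crux**: `LogMgfBoundL → HistoryTailL`. -/
theorem historyTailL_of_logMgfBoundL (h : LogMgfBoundL) : HistoryTailL := by
  refine historyTailL_of_ppHigh fun L hLo hL1 => ?_
  obtain ⟨t, γ₁, ht, hγ₁, hγ₁1, hF⟩ := h L hLo hL1
  refine ⟨1, 3, γ₁, one_pos, by norm_num, hγ₁, hγ₁1, fun F γ hFL hγ hγle => ?_⟩
  obtain ⟨j₀, hT⟩ := hF F γ hFL hγ hγle
  exact ⟨j₀, ppHigh_of_logMgfBound F hγ (hγle.trans hγ₁1) ht hT zero_le_one 3⟩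

theorem logMgfBoundL_of_tiltedMeanBoundL (h : TiltedMeanBoundL) : LogMgfBoundL := by
  intro L hLo hL1
  obtain ⟨t, γ₁, ht, hγ₁, hγ₁1, hF⟩ := h L hLo hL1
  refine ⟨t, γ₁, ht, hγ₁, hγ₁1, fun F γ hFL hγ hγle => ?_⟩
  obtain ⟨j₀, hT⟩ := hF F γ hFL hγ hγle
  exact ⟨j₀, logMgfBound_of_tiltedMeanBound F hγ ht.le hT⟩

end Summit.QuantumFields.YangMills.Cruxes.HistoryTailL.IdeasG3
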